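import Literature.NumberTheory.GaloisRepresentations.UnramifiedRadicalDescentAbsolute
import Literature.NumberTheory.GaloisRepresentations.SUnitsValuation
import HarnessLib

/-!
# Radicals of `K_S` with a `p`-power in a finite level `F ⊆ K_S` are, up to `F^×`-multiples and an exponent
# prime to `p`, roots of `S`-UNITS of `F` (the `Cl_S(F)[p^∞]`-term of the Kummer sequence dies in the limit)

Topic `NumberTheory/GaloisRepresentations`; namespace `Literature.NumberTheory.GaloisRepresentations`.
Everything here is **proved** (no definition, no named fact, no instance; D-0026).  Fourth file of the
radical-descent group (`UnramifiedRadicalDescent`, `…Absolute`, `…Open`).  For a number field `K`, a prime `p`,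
a set `S` of finite places of `K`, `N_S = ramificationSubgroup K S ≤ Γ_K` (`K_S = K̄^{N_S}`) and a finite level
`F ⊆ K_S` (`N_S ≤ Gal(K̄/F)`):

* `exists_eq_pow_mul_of_forall_dvd_log_valuation` — (any number field `F`, any set `T` of its finite places)
  if `M ∣ ord_w(b)` for every `w ∉ T`, then `b^{h_F} = a^M · ε` with `a ∈ F^×` and `ε` a `T`-unit
  (`ord_w(ε) = 0` for `w ∉ T`), `h_F = #Cl(𝓞_F)`: the ideal `𝔞 = ∏_{w ∉ T} w^{ord_w(b)/M}` has `𝔞^{h_F} = (a)`;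
* `dvd_log_valuation_of_pow_eq_of_forall_smul_eq` — if `β ∈ K_S` (fixed by `N_S`) has `β^N = b ∈ F^×`, then
  `N ∣ ord_w(b)` at every place `w` of `F` not above `S`: a finite Galois hull `L ⊆ K_S` of `F(β)` is
  unramified over `F` outside `S` (`isUnramifiedIn_of_ramificationSubgroup_le_galFixing` + transitivity of
  `IsUnramifiedAt`), so `ord_W(b) = ord_w(b)` for `W ∣ w` (Mathlib `valuation_liesOver`,
  `IsUnramifiedIn.ramificationIdx_eq_one`) and `ord_W(b) = N·ord_W(β)`;
* **`exists_pow_eq_pow_mul_sUnit_of_radical`** — with `h_F = p^t·h'`, `p ∤ h'`: for every `k` and every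
  `b ∈ F^×` admitting a `p^{k+t}`-th root in `K_S`, `b^{h'} = a^{p^k} · ε` with `a ∈ F^×` and `ε` an `S`-unit of
  `F` (`ord_w(ε) = 0` for `w ∤ S`).  This is the element-level content of "the image of a class of
  `H¹(G_S(F), μ_{p^{k+t}})` in `Cl_S(F)[p^{k+t}]`, pushed down to `Cl_S(F)[p^k]` by `p^t`, vanishes; hence the
  reduction of the class to `μ_{p^k}` comes from `𝒪_{F,S}^× ⊗ ℤ/p^k`" — the Kummer sequence
  `0 → 𝒪_{F,S}^×/p^k → H¹(G_S(F), μ_{p^k}) → Cl_S(F)[p^k] → 0` (Neukirch–Schmidt–Wingberg (8.3.4)) in the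
  limit over `k`, class-field-theory free.

Consumer: the cokernel half (ρ3) of ROW 2 of the (α3) descent on the deciding crux of cell `bsd-print-cf2`
(`Summits/…/Theorems/PrintCf2RubinValueTwoRowTwo…`), where classes come in `k`-towers.  NOT here: the
cohomological reading (Kummer classes; Summits side), the passage from `S`-units to units.

## References

* J. Neukirch, A. Schmidt, K. Wingberg, *Cohomology of Number Fields*, 2nd ed. (2008), VIII §3, Prop. (8.3.4)
  (the Kummer sequence with `Cl_S`) and (8.3.11) (proof). [NeukirchSchmidtWingberg2008]
* J. Neukirch, *Algebraic Number Theory* (1999), Ch. I §6 (6.3) (finiteness of the class number), Ch. VI §1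
  (`S`-units). [NeukirchANT1999]

## Mathlib / tree search

Tree: `exists_isGalois_subset_ramificationSubgroup_le_galFixing`, `isUnramifiedIn_of_ramificationSubgroup_le_galFixing`
(`UnramifiedRadicalDescentAbsolute`), `FractionalIdeal.count_spanSingleton_eq_neg_log_valuation` (`Automorphic/IdeleIdealClass`),
`SUnits.finite_setOf_valuation_ne_one` (`SUnitsValuation`); the `F ≤ L` / `Algebra F L` / `IsUnramifiedAt.of_restrictScalars`
pattern of `UnramifiedRadicalDescentOpen`.  Mathlib: `FractionalIdeal.count_finprod`, `ClassGroup.mk_eq_one_iff`, `pow_card_eq_one`,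
`HeightOneSpectrum.valuation_liesOver`, `Ideal.ramificationIdx'_eq_ramificationIdx`, `Ideal.exists_maximal_ideal_liesOver_of_isIntegral`,
`Nat.ordProj_mul_ordCompl_eq_self`.  `lean search 'pow_mul_sUnit_of_radical|dvd_log_valuation_of_pow_eq'`: no prior statement.
-/

noncomputable section

open scoped NumberField nonZeroDivisors IntermediateField
open NumberField IsDedekindDomain IsDedekindDomain.HeightOneSpectrum Field WithZero IntermediateField
open Literature.NumberTheory.GaloisRepresentations.LocalWeilDatum
open Literature.NumberTheory.Automorphic (FractionalIdeal.count_spanSingleton_eq_neg_log_valuation)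

namespace Literature.NumberTheory.GaloisRepresentations

/-! ### §1. `M ∣ ord_w(b)` off `T` ⟹ `b^{h_F} = a^M · (T-unit)` -/

/-- **The divisor-descent step at one field.**  Let `F` be a number field, `T` a set of finite places of `F`,
`M ≥ 1`, and `b ∈ F^×` with `M ∣ ord_w(b)` for every `w ∉ T`.  Then `b^{h_F} = a^M · ε` with `a ∈ F^×` and `ε ∈ F^×`
a `T`-unit (`ord_w(ε) = 0`, i.e. `w.valuation F ε = 1`, for all `w ∉ T`), where `h_F = #Cl(𝓞_F)`: the fractional
ideal `𝔞 = ∏_{w ∉ T} w^{ord_w(b)/M}` has `𝔞^{h_F} = (a⁻¹)`-type generator (Mathlib `ClassGroup.mk_eq_one_iff`,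
`pow_card_eq_one`), and `ε = b^{h_F}·a^{-M}` has no divisor off `T`.  (The `Cl`-term of the Kummer sequence
`0 → 𝒪_{F,T}^×/M → {b : M ∣ div(b) off T}/F^{×M} → Cl_T(F)[M] → 0`, killed by `h_F`.)
[cite: NeukirchSchmidtWingberg2008, VIII §3 Prop. (8.3.4)] -/
theorem exists_eq_pow_mul_of_forall_dvd_log_valuation {F : Type} [Field F] [NumberField F]
    (T : Set (HeightOneSpectrum (𝓞 F))) (M : ℕ) {b : F} (hb : b ≠ 0)
    (hdvd : ∀ w : HeightOneSpectrum (𝓞 F), w ∉ T → (M : ℤ) ∣ log (w.valuation F b)) :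
    ∃ a ε : F, a ≠ 0 ∧ ε ≠ 0 ∧ (∀ w : HeightOneSpectrum (𝓞 F), w ∉ T → w.valuation F ε = 1) ∧
      b ^ Fintype.card (ClassGroup (𝓞 F)) = a ^ M * ε := by
  classical
  set h : ℕ := Fintype.card (ClassGroup (𝓞 F)) with hh
  -- the descended exponents
  let n : HeightOneSpectrum (𝓞 F) → ℤ := fun w => if w ∈ T then 0 else log (w.valuation F b) / M
  have hn : ∀ w : HeightOneSpectrum (𝓞 F), w ∉ T → (M : ℤ) * n w = log (w.valuation F b) := by
    intro w hw
    simp only [n, if_neg hw]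
    exact Int.mul_ediv_cancel' (hdvd w hw)
  have hn_fin : ∀ᶠ w : HeightOneSpectrum (𝓞 F) in Filter.cofinite, n w = 0 := by
    rw [Filter.eventually_cofinite]
    refine (SUnits.finite_setOf_valuation_ne_one (x := b) hb).subset fun w hw => ?_
    rw [Set.mem_setOf_eq] at hw ⊢
    intro h1
    apply hw
    by_cases hwT : w ∈ T
    · simp only [n, if_pos hwT]
    · simp only [n, if_neg hwT, h1, log_one, Int.zero_ediv]
  -- the fractional ideal `𝔞 = ∏ w ^ n_w` and a generator of `𝔞 ^ h`
  set 𝔞 : FractionalIdeal (𝓞 F)⁰ F :=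
    ∏ᶠ w : HeightOneSpectrum (𝓞 F), (w.asIdeal : FractionalIdeal (𝓞 F)⁰ F) ^ n w with h𝔞def
  have h𝔞0 : 𝔞 ≠ 0 := by
    rw [h𝔞def]
    refine finprod_induction (fun I : FractionalIdeal (𝓞 F)⁰ F => I ≠ 0) one_ne_zero
      (fun I J hI hJ => mul_ne_zero hI hJ) fun w => ?_
    exact zpow_ne_zero _ (FractionalIdeal.coeIdeal_ne_zero.mpr w.ne_bot)
  have hcount : ∀ w : HeightOneSpectrum (𝓞 F), FractionalIdeal.count F w 𝔞 = n w := fun w =>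
    FractionalIdeal.count_finprod F w n hn_fin
  have hprinc : ((((Units.mk0 𝔞 h𝔞0) ^ h : (FractionalIdeal (𝓞 F)⁰ F)ˣ) :
      FractionalIdeal (𝓞 F)⁰ F) : Submodule (𝓞 F) F).IsPrincipal := by
    rw [← ClassGroup.mk_eq_one_iff, map_pow, hh, pow_card_eq_one]
  obtain ⟨c, hc⟩ := (FractionalIdeal.isPrincipal_iff _).mp hprinc
  rw [Units.val_pow_eq_pow_val, Units.val_mk0] at hc
  have hc0 : c ≠ 0 := by
    intro h0
    rw [h0, FractionalIdeal.spanSingleton_zero] at hc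
    exact pow_ne_zero _ h𝔞0 hc
  have hlogc : ∀ w : HeightOneSpectrum (𝓞 F), log (w.valuation F c) = -(h * n w) := by
    intro w
    have h1 := FractionalIdeal.count_spanSingleton_eq_neg_log_valuation (R := 𝓞 F) w (Units.mk0 c hc0)
    rw [Units.val_mk0, ← hc, FractionalIdeal.count_pow, hcount w] at h1
    linarith
  -- `ε = b^h · c^M`, `a = c⁻¹`
  refine ⟨c⁻¹, b ^ h * c ^ M, inv_ne_zero hc0, mul_ne_zero (pow_ne_zero _ hb) (pow_ne_zero _ hc0),
    fun w hw => ?_, ?_⟩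
  · have hb0 : w.valuation F b ≠ 0 := (Valuation.ne_zero_iff _).2 hb
    have hc0' : w.valuation F c ≠ 0 := (Valuation.ne_zero_iff _).2 hc0
    have hne : w.valuation F (b ^ h * c ^ M) ≠ 0 :=
      (Valuation.ne_zero_iff _).2 (mul_ne_zero (pow_ne_zero _ hb) (pow_ne_zero _ hc0))
    rw [← exp_log hne, ← exp_zero]
    congr 1
    rw [map_mul, map_pow, map_pow, log_mul (pow_ne_zero _ hb0) (pow_ne_zero _ hc0'), log_pow, log_pow,
      hlogc w, ← hn w hw]
    simp only [nsmul_eq_mul]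
    ring
  · rw [inv_pow, mul_left_comm, inv_mul_cancel₀ (pow_ne_zero _ hc0), mul_one]

/-! ### §2. A radical in `K_S` forces `N ∣ ord_w` of its `N`-th power off `S` -/

variable (K : Type) [Field K] [NumberField K]

/-- **`β ∈ K_S`, `β^N = b ∈ F` ⟹ `N ∣ ord_w(b)` for every place `w` of `F` not above `S`.**  Here `F ⊆ K̄`
is a number field containing `K`, inside `K_S` (`N_S ≤ Gal(K̄/F)`), `β ∈ K̄` is fixed by `N_S`, and `w.under (𝓞 K) ∉ S`.
Proof: a finite Galois hull `L ⊆ K_S` of `F ∪ {β}` over `K` (tree `exists_isGalois_subset_ramificationSubgroup_le_galFixing`)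
is unramified at every place of `K` outside `S` (`isUnramifiedIn_of_ramificationSubgroup_le_galFixing`), hence `L/F` is
unramified at `w` (transitivity, Mathlib `IsUnramifiedAt.of_restrictScalars`); for a place `W ∣ w` of `L`,
`ord_W(b) = e(W|w)·ord_w(b) = ord_w(b)` (Mathlib `valuation_liesOver`, `IsUnramifiedIn.ramificationIdx_eq_one`) and
`ord_W(b) = N·ord_W(β)`.  ("`F(b^{1/N})/F` unramified at `w ∤ N` iff `ord_w(b) ≡ 0 mod N`", the "only if" half.)
[cite: NeukirchSchmidtWingberg2008, VIII §3 Prop. (8.3.4) (proof)] -/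
theorem dvd_log_valuation_of_pow_eq_of_forall_smul_eq {S : Set (HeightOneSpectrum (𝓞 K))}
    (F : IntermediateField K (AlgebraicClosure K)) [NumberField F]
    (hNF : ramificationSubgroup K S ≤ galFixing K F)
    {β : AlgebraicClosure K} (hβN : ∀ g ∈ ramificationSubgroup K S, g • β = β)
    (N : ℕ) {b : F} (hb : b ≠ 0) (hβ : β ^ N = (b : AlgebraicClosure K))
    (w : HeightOneSpectrum (𝓞 F)) (hw : w.under (𝓞 K) ∉ S) :
    (N : ℤ) ∣ log (w.valuation F b) := by
  classical
  haveI : FiniteDimensional K F := Module.Finite.of_restrictScalars_finite ℚ K F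
  -- the degenerate exponent `N = 0`: `b = 1`
  rcases Nat.eq_zero_or_pos N with rfl | hN
  · have hb1 : b = 1 := by
      apply Subtype.ext
      rw [← hβ, pow_zero]
      rfl
    rw [hb1, map_one, log_one]
    exact dvd_zero _
  -- the finite Galois hull `L ⊆ K_S` of `F` and `β`
  set bF := Module.finBasis K F with hbFdef
  set T : Set (AlgebraicClosure K) :=
    {β} ∪ Set.range (fun i => ((bF i : F) : AlgebraicClosure K)) with hT
  have hTfin : T.Finite := (Set.finite_singleton β).union (Set.finite_range _)
  have hTfix : ∀ t ∈ T, ∀ g ∈ ramificationSubgroup K S, g • t = t := by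
    rintro t (ht | ⟨i, rfl⟩) g hg
    · rw [Set.mem_singleton_iff.mp ht]; exact hβN g hg
    · exact (mem_galFixing_iff K).mp (hNF hg) _ (bF i).2
  obtain ⟨L, hLfin, hLgal, hTL, hLN⟩ :=
    exists_isGalois_subset_ramificationSubgroup_le_galFixing K hTfin hTfix
  haveI := hLfin
  haveI := hLgal
  haveI : NumberField L := NumberField.of_module_finite K L
  have hβL : β ∈ L := hTL (Or.inl rfl)
  have hFL : F ≤ L := by
    intro x hx
    have hx' : (⟨x, hx⟩ : F) = ∑ i, bF.repr ⟨x, hx⟩ i • bF i := (bF.sum_repr ⟨x, hx⟩).symm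
    have hx'' : x = ∑ i, bF.repr ⟨x, hx⟩ i • ((bF i : F) : AlgebraicClosure K) := by
      have := congrArg (fun y : F => (y : AlgebraicClosure K)) hx'
      simpa only [IntermediateField.coe_sum, IntermediateField.coe_smul] using this
    rw [hx'']
    exact L.sum_mem fun i _ => L.smul_mem (hTL (Or.inr ⟨i, rfl⟩))
  letI : Algebra F L := (IntermediateField.inclusion hFL).toRingHom.toAlgebra
  haveI : IsScalarTower K F L := IsScalarTower.of_algebraMap_eq fun x => Subtype.ext rfl
  haveI : IsScalarTower (𝓞 K) (𝓞 F) (𝓞 L) := IsScalarTower.of_algebraMap_eq fun x =>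
    RingOfIntegers.ext rfl
  -- `L/F` is unramified at `w`
  have hunrK : Algebra.IsUnramifiedIn (𝓞 L) (w.under (𝓞 K)).asIdeal :=
    isUnramifiedIn_of_ramificationSubgroup_le_galFixing K L hLN hw
  have hunr : Algebra.IsUnramifiedIn (𝓞 L) w.asIdeal := by
    intro P hP hPw
    haveI := hP
    haveI := hPw
    haveI : P.LiesOver (w.under (𝓞 K)).asIdeal := by
      rw [IsDedekindDomain.HeightOneSpectrum.under_asIdeal]
      haveI : w.asIdeal.LiesOver (w.asIdeal.under (𝓞 K)) := ⟨rfl⟩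
      exact Ideal.LiesOver.trans P w.asIdeal (w.asIdeal.under (𝓞 K))
    haveI : Algebra.IsUnramifiedAt (𝓞 K) P := hunrK P hP inferInstance
    exact Algebra.IsUnramifiedAt.of_restrictScalars (𝓞 K) P
  -- a place `W` of `L` above `w`, with `e(W|w) = 1`
  haveI : w.asIdeal.IsMaximal := w.isMaximal
  obtain ⟨P, hPmax, hPw⟩ := Ideal.exists_maximal_ideal_liesOver_of_isIntegral (S := 𝓞 L) w.asIdeal
  haveI := hPw
  let W : HeightOneSpectrum (𝓞 L) := ⟨P, hPmax.isPrime, Ideal.ne_bot_of_liesOver_of_ne_bot w.ne_bot P⟩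
  haveI : W.asIdeal.LiesOver w.asIdeal := hPw
  have he : w.asIdeal.ramificationIdx' W.asIdeal = 1 := by
    rw [Ideal.ramificationIdx'_eq_ramificationIdx w.asIdeal W.asIdeal w.ne_bot]
    exact hunr.ramificationIdx_eq_one inferInstance
  -- valuation bookkeeping
  set βL : L := ⟨β, hβL⟩ with hβLdef
  have hbL : algebraMap F L b = βL ^ N := by
    apply Subtype.ext
    change ((b : F) : AlgebraicClosure K) = ((βL ^ N : L) : AlgebraicClosure K)
    rw [← hβ]
    rfl
  have hβL0 : βL ≠ 0 := by
    intro h0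
    apply hb
    apply Subtype.ext
    rw [← hβ, show β = ((βL : L) : AlgebraicClosure K) from rfl, h0, ZeroMemClass.coe_zero,
      ZeroMemClass.coe_zero, zero_pow hN.ne']
  have hval : w.valuation F b = W.valuation L (algebraMap F L b) := by
    rw [← HeightOneSpectrum.valuation_liesOver L w W b, he, pow_one]
  have hβW0 : W.valuation L βL ≠ 0 := (Valuation.ne_zero_iff _).2 hβL0
  refine ⟨log (W.valuation L βL), ?_⟩
  rw [hval, hbL, map_pow, log_pow, nsmul_eq_mul]

/-! ### §3. The `S`-unit form: `b^{h'} = a^{p^k} · (S-unit)` for radicals at depth `k + t`, `h_F = p^t h'` -/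

/-- `x^n` a `T`-unit ⟹ `x` a `T`-unit (valuations are torsion-free). [folklore] -/
private theorem valuation_eq_one_of_pow {F : Type} [Field F] [NumberField F] (w : HeightOneSpectrum (𝓞 F))
    {x : F} (hx : x ≠ 0) {n : ℕ} (hn : n ≠ 0) (h : w.valuation F (x ^ n) = 1) : w.valuation F x = 1 := by
  have hx0 : w.valuation F x ≠ 0 := (Valuation.ne_zero_iff _).2 hx
  rw [map_pow] at h
  have h1 : log (w.valuation F x ^ n) = 0 := by rw [h, log_one]
  rw [log_pow] at h1
  have h2 : log (w.valuation F x) = 0 := by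
    rcases mul_eq_zero.mp h1 with h3 | h3
    · exact absurd (Int.natCast_eq_zero.mp h3) hn
    · exact h3
  rw [← exp_log hx0, h2, exp_zero]

/-- **Radicals of `K_S` at depth `k + t` over `F` are roots of `S`-units of `F`, up to `F^{×p^k}` and an exponent
prime to `p`.**  For `F ⊆ K_S` finite over `K` (`N_S ≤ Gal(K̄/F)`) there are `t, h'` with `p ∤ h'` (namely
`#Cl(𝓞_F) = p^t·h'`) such that: for every `k` and every `b ∈ F^×` having a `p^{k+t}`-th root `β ∈ K̄` fixed by `N_S`,
`b^{h'} = a^{p^k} · ε` with `a ∈ F^×` and `ε` an `S`-unit of `F` (`w.valuation F ε = 1` at every `w` with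
`w.under (𝓞 K) ∉ S`).  (§2: `p^{k+t} ∣ ord_w(b)` off `S`; §1: `b^{p^t h'} = a₀^{p^{k+t}}·ε₀`; then
`ε = b^{h'}·a₀^{-p^k}` has `ε^{p^t} = ε₀`, so `ε` is an `S`-unit.)  Cohomologically: the image in `Cl_S(F)` of a
class of `H¹(G_S(F), μ_{p^k})` that lifts to `μ_{p^{k+t}}` is `p^t`·(a `p`-power-torsion class), whose
prime-to-`p` multiple `h'` vanishes — the `Cl_S(F)`-term of the Kummer sequence (8.3.4) dies in `lim←_k`.
[cite: NeukirchSchmidtWingberg2008, VIII §3 Prop. (8.3.4)] -/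
theorem exists_pow_eq_pow_mul_sUnit_of_radical {p : ℕ} [Fact p.Prime] {S : Set (HeightOneSpectrum (𝓞 K))}
    (F : IntermediateField K (AlgebraicClosure K)) [NumberField F]
    (hNF : ramificationSubgroup K S ≤ galFixing K F) :
    ∃ t h' : ℕ, ¬ p ∣ h' ∧ ∀ (k : ℕ) (b : F), b ≠ 0 →
      (∃ β : AlgebraicClosure K, (∀ g ∈ ramificationSubgroup K S, g • β = β) ∧
        β ^ p ^ (k + t) = (b : AlgebraicClosure K)) →
      ∃ a ε : F, a ≠ 0 ∧ ε ≠ 0 ∧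
        (∀ w : HeightOneSpectrum (𝓞 F), w.under (𝓞 K) ∉ S → w.valuation F ε = 1) ∧
        b ^ h' = a ^ p ^ k * ε := by
  classical
  have hp : p.Prime := Fact.out
  set h : ℕ := Fintype.card (ClassGroup (𝓞 F)) with hh
  have hh0 : h ≠ 0 := Fintype.card_ne_zero
  set t : ℕ := h.factorization p with ht
  set h' : ℕ := h / p ^ t with hh'
  have hdecomp : p ^ t * h' = h := Nat.ordProj_mul_ordCompl_eq_self h p
  have hndvd : ¬ p ∣ h' := Nat.not_dvd_ordCompl hp hh0
  refine ⟨t, h', hndvd, fun k b hb ⟨β, hβN, hβ⟩ => ?_⟩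
  set T : Set (HeightOneSpectrum (𝓞 F)) := {w | w.under (𝓞 K) ∈ S} with hTdef
  have hdvd : ∀ w : HeightOneSpectrum (𝓞 F), w ∉ T → ((p ^ (k + t) : ℕ) : ℤ) ∣ log (w.valuation F b) :=
    fun w hw => dvd_log_valuation_of_pow_eq_of_forall_smul_eq K F hNF hβN (p ^ (k + t)) hb hβ w hw
  obtain ⟨a, ε₀, ha0, hε₀0, hε₀, hbε⟩ := exists_eq_pow_mul_of_forall_dvd_log_valuation T (p ^ (k + t)) hb hdvd
  -- `ε = b^{h'} · a^{-p^k}`, `ε^{p^t} = ε₀`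
  set ε : F := b ^ h' * (a ^ p ^ k)⁻¹ with hεdef
  have hε0 : ε ≠ 0 := mul_ne_zero (pow_ne_zero _ hb) (inv_ne_zero (pow_ne_zero _ ha0))
  have hεpow : ε ^ p ^ t = ε₀ := by
    have h1 : b ^ h = (a ^ p ^ k) ^ p ^ t * ε₀ := by rw [hbε, ← pow_mul, ← pow_add, add_comm]
    rw [hεdef, mul_pow, ← pow_mul, mul_comm h' (p ^ t), hdecomp, h1, inv_pow, mul_comm ((a ^ p ^ k) ^ p ^ t) ε₀,
      mul_inv_cancel_right₀ (pow_ne_zero _ (pow_ne_zero _ ha0))]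
  refine ⟨a, ε, ha0, hε0, fun w hw => ?_, ?_⟩
  · exact valuation_eq_one_of_pow w hε0 (pow_ne_zero t hp.ne_zero) (by rw [hεpow]; exact hε₀ w hw)
  · rw [hεdef, mul_left_comm, mul_inv_cancel₀ (pow_ne_zero _ ha0), mul_one]

end Literature.NumberTheory.GaloisRepresentations

end
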